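/-
Copyright (c) 2026 the pub-hodgecm-mathlib formalisation cell (harness21).  Prover seat hodgecm-mathlib-LH7-p04 (g3), 2026-09-02 (LH7 leaf ED. 3 road:
«the eigencharacter of an `L²`-eigenfunction of `G(𝔸_K)` is automorphic» for a GENERAL, non-commutative datum; one-dimensional discrete automorphic
representations are automorphic characters).
-/
import Literature.NumberTheory.Automorphic.AutomorphicQuotientSubgroupErgodic
import Literature.NumberTheory.Automorphic.AutomorphicCharacterLineUnique
import HarnessLib

/-!
# Eigencharacters of `L²`-eigenfunctions on a homogeneous space are trivial on the stabilizer; one-dimensional automorphic representations of a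
# general `G(𝔸_K)` are automorphic characters

Topic `NumberTheory/Automorphic`; THEOREMS ONLY (no definition, no instance, no named fact, no notation, no `sorry`).  Removes the commutativity hypothesis
`hcomm` from ★ `AdelicCommutativeDatumEigencharacter` ∕ ★ `AutomorphicCharacterLine` §4–§5 («every irreducible `W ≤ L²` of a COMMUTATIVE datum is the line
of an automorphic character»): for an ARBITRARY adelic datum with `G(𝔸_K)` locally compact second countable, an `L²`-eigenfunction `f ≠ 0` of the whole
regular representation, `R(g) f = c(g) f`, has `c = 1` on `A_G · G(K)` — although `R(γ)`, `γ ∈ G(K)`, is NOT the identity of `L²` when `G` is not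
commutative.

THE MATHEMATICS (a pointwise statement hidden in an a.e. one; [Zimmer1984] App. B «strictly invariant versions», [BorelJacquet1979] §4.2).  Let a locally
compact second countable group `G` act continuously and transitively on a Borel space `X` with invariant s-finite `μ`, `x₀ ∈ X` with stabilizer `H`,
`χ : G →* ℂˣ` continuous, and `f : X → ℂ` strongly measurable, not a.e. zero, with `f (g • x) = χ(g) f(x)` for a.e. `x`, for every `g`.  Then
`χ = 1` on `H`.  Proof: lift `F = f ∘ Θ`, `Θ(g) = g • x₀` (null sets correspond, ★ `measure_eq_zero_iff_measure_preimage_orbit_eq_zero`); `F` is EXACTLY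
right-`H`-invariant and, by Fubini, for a.e. `y` the function `g ↦ χ(g)⁻¹ F(g y)` is a.e. the constant `F(y)`.  Call `y` GOOD if `g ↦ χ(g)⁻¹ F(g y)` is
a.e. SOME constant `F'(y)`; the good set is conull and invariant under left translations (`F'(k y) = χ(k) F'(y)`), hence ALL of `G` (a conull set is
non-empty and `G` is one orbit).  The everywhere-defined `F'` is exactly `χ`-equivariant on the left, exactly `H`-invariant on the right (as `F` is),
and `F' = F` a.e., so `F'(y₁) ≠ 0` somewhere, whence `F'(1) ≠ 0`; finally `F'(h) = F'(1 · h) = F'(1)` and `F'(h) = F'(h · 1) = χ(h) F'(1)` give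
`χ(h) = 1`.

* §1 (abstract) **`eq_one_of_forall_smul_ae_eq_mul_of_mem_stabilizer`** — the statement above.
* §2 `AdelicGroupData.apply_eq_one_of_forall_rightRegular_apply_eq_smul` — **for `0 ≠ f ∈ L²(G(𝔸_K) ⧸ A_G G(K))` with `R(g) f = c(g) f` for all `g`,
  `c = 1` on `A_G · G(K)`** (and `c` is multiplicative, unitary, continuous: `mul_of_forall_rightRegular_apply_eq_smul`, `norm_of_…`, `continuous_of_…`);
  **`DiscreteAutomorphicRep.exists_eq_ofChar_of_forall_apply_eq_smul`** — a discrete automorphic representation on which `G(𝔸_K)` acts by scalars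
  `c(g)` IS `ofChar ψ μ` for an automorphic character `ψ` (namely `ψ = c⁻¹`; ★ `eq_ofChar_iff_forall_apply_eq_smul`);
  **`DiscreteAutomorphicRep.exists_eq_ofChar_of_isOneDimensional`** ∕ `isOneDimensional_iff_exists_eq_ofChar` — **the one-dimensional discrete
  automorphic representations of ANY `G(𝔸_K)` are exactly the lines of the automorphic characters** (★ `exists_eq_ofChar` needed `G(𝔸_K)` commutative).

CONSUMER (cell `hodgecm-mathlib`, crux H413 = stmt-HodgeConjecture-24833, line LH7, leaf ED. 3 print organ O8a `PKsaU2Shape` «a discrete automorphic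
representation of the quasi-split `U(2)` that is one-dimensional at almost all places is an automorphic character `θ ∘ det`»): after strong
approximation makes `SU(Φ₂)(𝔸_f)` act trivially and ★ `AutomorphicCharacterLineSubgroup` makes `P` one-dimensional, `exists_eq_ofChar_of_isOneDimensional`
produces the AUTOMORPHIC character of `U(Φ₂)(𝔸)` through which `P` factors.  Nothing here is specific to unitary groups.
HONEST LABEL: generic `L²` bookkeeping; HC_CM is proved only modulo the printed citations of that programme until its rung 0 closes; this file proves no
printed citation of it.

## References
* [Zimmer1984] R. J. Zimmer, *Ergodic theory and semisimple groups* (1984), §2.2, App. B (a.e. versus strict invariance).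
* [BorelJacquet1979] A. Borel, H. Jacquet, *Automorphic forms and automorphic representations*, Proc. Sympos. Pure Math. XXXIII.1 (1979), §4.2–§4.6
  (characters of `G(𝔸)` trivial on `G(F)`; one-dimensional automorphic representations).
* [Gelbart1975] S. Gelbart, *Automorphic forms on adele groups* (1975), §2.A.
-/

set_option autoImplicit false

noncomputable section

open MeasureTheory Filter Set Topology
open scoped ENNReal Pointwise InnerProductSpace

namespace Literature.NumberTheory.Automorphic

/-! ## §1 Eigencharacters of eigenfunctions on a homogeneous space are trivial on the stabilizer -/

section Abstract

variable {G X : Type*} [Group G] [TopologicalSpace G] [IsTopologicalGroup G]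
  [SecondCountableTopology G] [LocallyCompactSpace G] [MulAction G X] [TopologicalSpace X] [MeasurableSpace X]
  [BorelSpace X] [ContinuousSMul G X] [MulAction.IsPretransitive G X]

/-- **The eigencharacter of an a.e. eigenfunction on a homogeneous space is trivial on the stabilizer.**  Let a locally compact second countable group
`G` act continuously and transitively on a Borel space `X` with an invariant s-finite measure `μ`; let `χ : G →* ℂˣ` be continuous and let
`f : X → ℂ` be strongly measurable, NOT a.e. zero, with `f (g • x) = χ(g) · f(x)` for `μ`-a.e. `x`, for every `g ∈ G`.  Then `χ(h) = 1` for every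
`h` in the stabilizer of any point `x₀`.  (Lift to `G` along `Θ(g) = g • x₀`; strictify: for every `y` the function `g ↦ χ(g)⁻¹ F(g y)` is a.e. a
constant `F'(y)` — true for a.e. `y` by Fubini, and the set of such `y` is left-invariant and conull, hence everything; `F'` is exactly left
`χ`-equivariant and right `Stab(x₀)`-invariant with `F'(1) ≠ 0`; compare `F'(1 · h) = F'(h · 1)`.) [cite: Zimmer1984, App. B] [cite: BorelJacquet1979, §4.2] -/
theorem eq_one_of_forall_smul_ae_eq_mul_of_mem_stabilizer (μ : Measure X) [SFinite μ] [SMulInvariantMeasure G X μ]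
    {f : X → ℂ} (hfm : StronglyMeasurable f) (hf0 : ¬ f =ᵐ[μ] 0) (χ : G →* ℂˣ) (hχ : Continuous fun g => (χ g : ℂ))
    (hf : ∀ g : G, ∀ᵐ x ∂μ, f (g • x) = χ g * f x) {x₀ : X} {h : G} (hh : h ∈ MulAction.stabilizer G x₀) :
    χ h = 1 := by
  borelize G
  haveI : NeZero μ := ⟨fun h0 => hf0 (by rw [h0, ae_zero]; exact eventually_bot)⟩
  set ν : Measure G := Measure.haar with hν
  have hν0 : ν univ ≠ 0 := isOpen_univ.measure_ne_zero ν ⟨1, trivial⟩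
  set Θ : G → X := fun g => g • x₀ with hΘ
  have hΘm : Measurable Θ := (continuous_id.smul continuous_const).measurable
  have key : ∀ A : Set X, MeasurableSet A → (μ A = 0 ↔ ν (Θ ⁻¹' A) = 0) := fun A hA =>
    measure_eq_zero_iff_measure_preimage_orbit_eq_zero μ ν x₀ hA
  have hfmeas : Measurable f := hfm.measurable
  have hχm : Measurable fun g => (χ g : ℂ) := hχ.measurable
  set F : G → ℂ := fun y => f (Θ y) with hF
  have hFm : Measurable F := hfmeas.comp hΘm
  -- (a) the a.e. eigen-identity lifted to `G`
  have hFg : ∀ g : G, ∀ᵐ y ∂ν, F (g * y) = χ g * F y := by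
    intro g
    have hA : MeasurableSet {x | f (g • x) ≠ χ g * f x} :=
      (measurableSet_eq_fun (hfmeas.comp (measurable_const_smul g)) (measurable_const.mul hfmeas)).compl
    have h0 : μ {x | f (g • x) ≠ χ g * f x} = 0 := ae_iff.1 (hf g)
    have h1 := (key _ hA).1 h0
    rw [ae_iff]
    have hset : {y | ¬F (g * y) = χ g * F y} = Θ ⁻¹' {x | f (g • x) ≠ χ g * f x} := by
      ext y
      simp only [mem_setOf_eq, mem_preimage, hF, hΘ, mul_smul, ne_eq]
    rw [hset]
    exact h1
  -- (b) exact right invariance under the stabilizer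
  have hFH : ∀ y : G, F (y * h) = F y := by
    intro y
    simp only [hF, hΘ, mul_smul, MulAction.mem_stabilizer_iff.1 hh]
  -- (c) Fubini: for a.e. `y`, `g ↦ χ g⁻¹ F (g y)` is a.e. the constant `F y`
  have hmeas : MeasurableSet {p : G × G | F (p.1 * p.2) = χ p.1 * F p.2} :=
    measurableSet_eq_fun (hFm.comp measurable_mul) ((hχm.comp measurable_fst).mul (hFm.comp measurable_snd))
  have hae : ∀ᵐ y ∂ν, ∀ᵐ g ∂ν, F (g * y) = χ g * F y :=
    (Measure.ae_ae_comm hmeas).1 (ae_of_all _ hFg)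
  -- uniqueness of such a constant
  have huniq : ∀ (y : G) (a b : ℂ), (∀ᵐ g ∂ν, F (g * y) = χ g * a) → (∀ᵐ g ∂ν, F (g * y) = χ g * b) → a = b := by
    intro y a b ha hb
    by_contra hab
    have hfalse : ∀ᵐ _g ∂ν, False := by
      filter_upwards [ha, hb] with g h1 h2
      exact hab (mul_left_cancel₀ (Units.ne_zero (χ g)) (h1.symm.trans h2))
    have h0 := ae_iff.1 hfalse
    simp only [not_false_eq_true, setOf_true] at h0
    exact hν0 h0
  -- (d) left translates of good points are good, with constant multiplied by `χ`
  have hgood_mul : ∀ (k y : G) (a : ℂ), (∀ᵐ g ∂ν, F (g * y) = χ g * a) →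
      ∀ᵐ g ∂ν, F (g * (k * y)) = χ g * (χ k * a) := by
    intro k y a ha
    have h1 : ∀ᵐ g ∂ν, F ((g * k) * y) = χ (g * k) * a := by
      rw [ae_iff] at ha ⊢
      exact (measure_mul_right_null (s := {g' : G | ¬ (F (g' * y) = χ g' * a)}) ν k).2 ha
    filter_upwards [h1] with g hg
    rw [← mul_assoc, hg, map_mul, Units.val_mul, mul_assoc]
  -- (e) every point is good
  haveI : (ae ν).NeBot := ae_neBot.2 fun h0 => hν0 (by rw [h0, Measure.coe_zero, Pi.zero_apply])
  obtain ⟨y₀, hy₀⟩ := hae.exists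
  have hall : ∀ y : G, ∃ a : ℂ, ∀ᵐ g ∂ν, F (g * y) = χ g * a := fun y =>
    ⟨χ (y * y₀⁻¹) * F y₀, by
      have h1 := hgood_mul (y * y₀⁻¹) y₀ (F y₀) hy₀
      rwa [inv_mul_cancel_right] at h1⟩
  choose F' hF' using hall
  -- (f) the strict version `F'`: exactly equivariant, exactly right-`h`-invariant, equal to `F` at good points
  have hF'mul : ∀ k y : G, F' (k * y) = χ k * F' y := fun k y =>
    huniq _ _ _ (hF' (k * y)) (hgood_mul k y _ (hF' y))
  have hF'H : ∀ y : G, F' (y * h) = F' y := by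
    intro y
    refine huniq _ _ _ (hF' (y * h)) ?_
    filter_upwards [hF' y] with g hg
    rw [← mul_assoc, hFH, hg]
  have hF'F : ∀ y : G, (∀ᵐ g ∂ν, F (g * y) = χ g * F y) → F' y = F y := fun y hy =>
    huniq _ _ _ (hF' y) hy
  -- (g) `F' ≠ 0` somewhere, hence at `1`
  have hex : ∃ y₁ : G, (∀ᵐ g ∂ν, F (g * y₁) = χ g * F y₁) ∧ F y₁ ≠ 0 := by
    by_contra hcon
    push Not at hcon
    have hF0 : ∀ᵐ y ∂ν, F y = 0 := hae.mono hcon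
    have hνF : ν {y | F y ≠ 0} = 0 := by
      have := ae_iff.1 hF0
      simpa only [ne_eq] using this
    have hA : MeasurableSet {x | f x ≠ 0} := (measurableSet_eq_fun hfmeas measurable_const).compl
    have hμf : μ {x | f x ≠ 0} = 0 := (key _ hA).2 (by rw [← hνF]; rfl)
    exact hf0 (ae_iff.2 (by simpa only [Pi.zero_apply] using hμf))
  obtain ⟨y₁, hy₁, hFy₁⟩ := hex
  have hF'1 : F' 1 ≠ 0 := by
    have h1 : F' y₁ = F y₁ := hF'F y₁ hy₁
    have h2 : F' y₁ = χ y₁ * F' 1 := by rw [← hF'mul, mul_one]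
    intro h0
    rw [h0, mul_zero] at h2
    exact hFy₁ (h1 ▸ h2)
  -- (h) compare `F' (1 * h) = F' (h * 1)`
  have h1 : F' h = F' 1 := by rw [← hF'H 1, one_mul]
  have h2 : F' h = χ h * F' 1 := by rw [← hF'mul, mul_one]
  have h3 : (χ h : ℂ) = 1 := by
    have := h2.symm.trans h1
    rwa [mul_eq_right₀ hF'1] at this
  exact Units.ext h3

end Abstract

/-! ## §2 The automorphic quotient: eigencharacters are automorphic; one-dimensional representations are automorphic characters -/

namespace AdelicGroupData

universe u

variable {K : Type} [Field K] [NumberField K] (𝒢 : AdelicGroupData.{u} K)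
  (μ : Measure 𝒢.automorphicQuotient) [𝒢.IsAutomorphicMeasure μ]

/-- The eigenvalue function of a non-zero `L²`-eigenfunction of the regular representation is multiplicative:
`R(g h) f = R(g) (R(h) f)`. [cite: BorelJacquet1979, §4.2] -/
theorem mul_of_forall_rightRegular_apply_eq_smul {f : 𝒢.L2 μ} {c : 𝒢.Adelic → ℂ}
    (hf : ∀ g, 𝒢.rightRegular μ g f = c g • f) (hf0 : f ≠ 0) (g h : 𝒢.Adelic) : c (g * h) = c g * c h := by
  have h1 : c (g * h) • f = (c g * c h) • f := by
    have hgh : 𝒢.rightRegular μ (g * h) f = 𝒢.rightRegular μ g (𝒢.rightRegular μ h f) := by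
      rw [map_mul]
      rfl
    rw [← hf (g * h), hgh, hf h, map_smul, hf g, smul_smul, mul_comm]
  exact smul_left_injective ℂ hf0 h1

/-- The eigenvalues of a non-zero `L²`-eigenfunction are unitary: `‖c(g)‖ = 1` (`R(g)` is an isometry). [cite: BorelJacquet1979, §4.2] -/
theorem norm_of_forall_rightRegular_apply_eq_smul {f : 𝒢.L2 μ} {c : 𝒢.Adelic → ℂ}
    (hf : ∀ g, 𝒢.rightRegular μ g f = c g • f) (hf0 : f ≠ 0) (g : 𝒢.Adelic) : ‖c g‖ = 1 := by
  have h := 𝒢.norm_rightRegular_apply μ g f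
  rw [hf g, norm_smul] at h
  exact (mul_eq_right₀ (norm_ne_zero_iff.2 hf0)).1 h

/-- The eigenvalues of a non-zero `L²`-eigenfunction are non-zero. [cite: BorelJacquet1979, §4.2] -/
theorem ne_zero_of_forall_rightRegular_apply_eq_smul {f : 𝒢.L2 μ} {c : 𝒢.Adelic → ℂ}
    (hf : ∀ g, 𝒢.rightRegular μ g f = c g • f) (hf0 : f ≠ 0) (g : 𝒢.Adelic) : c g ≠ 0 := fun h0 => by
  have h := 𝒢.norm_of_forall_rightRegular_apply_eq_smul μ hf hf0 g
  rw [h0, norm_zero] at h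
  exact zero_ne_one h

/-- The eigenvalue function of a non-zero `L²`-eigenfunction is continuous (strong continuity of the regular representation, ★
`isStronglyContinuous_rightRegular_holds`: `c(g) = ⟪f, R(g) f⟫ / ⟪f, f⟫`). [cite: BorelJacquet1979, §4.2] -/
theorem continuous_of_forall_rightRegular_apply_eq_smul {f : 𝒢.L2 μ} {c : 𝒢.Adelic → ℂ}
    (hf : ∀ g, 𝒢.rightRegular μ g f = c g • f) (hf0 : f ≠ 0) : Continuous c := by
  have hsc : Continuous fun g : 𝒢.Adelic => 𝒢.rightRegular μ g f := 𝒢.isStronglyContinuous_rightRegular_holds μ f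
  have hff : (⟪f, f⟫_ℂ : ℂ) ≠ 0 := inner_self_ne_zero.mpr hf0
  have heq : c = fun g => ⟪f, 𝒢.rightRegular μ g f⟫_ℂ / ⟪f, f⟫_ℂ := by
    funext g
    rw [hf g, inner_smul_right, mul_div_assoc, div_self hff, mul_one]
  rw [heq]
  exact (continuous_const.inner hsc).div_const _

variable [LocallyCompactSpace 𝒢.Adelic] [SecondCountableTopology 𝒢.Adelic]

/-- **Eigencharacters of `L²`-eigenfunctions are automorphic.**  For an adelic group datum with `G(𝔸_K)` locally compact second countable, an
automorphic measure `μ` and `0 ≠ f ∈ L²(G(𝔸_K) ⧸ A_G G(K), μ)` with `R(g) f = c(g) f` for every `g ∈ G(𝔸_K)`: `c(h) = 1` for every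
`h ∈ A_G · G(K)`.  No commutativity is assumed (contrast ★ `rightRegular_apply_eq_self_of_mem_quotientSubgroup`, where `R(h)` itself is the identity
BECAUSE `G(𝔸_K)` is commutative); this is `eq_one_of_forall_smul_ae_eq_mul_of_mem_stabilizer` for the transitive action on the automorphic quotient,
whose base point has stabilizer `A_G · G(K)` (Mathlib `MulAction.stabilizer_quotient`), applied to the continuous homomorphism `g ↦ c(g⁻¹)` and the
a.e. identities `f (g • x) = c(g⁻¹) f x` (★ `coeFn_smul_ae_eq_of_rightRegular_apply_eq_smul`). [cite: BorelJacquet1979, §4.2] [cite: Zimmer1984, App. B] -/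
theorem apply_eq_one_of_forall_rightRegular_apply_eq_smul {f : 𝒢.L2 μ} {c : 𝒢.Adelic → ℂ}
    (hf : ∀ g, 𝒢.rightRegular μ g f = c g • f) (hf0 : f ≠ 0) {h : 𝒢.Adelic} (hh : h ∈ 𝒢.quotientSubgroup) :
    c h = 1 := by
  haveI : MulAction.IsPretransitive 𝒢.Adelic 𝒢.automorphicQuotient :=
    inferInstanceAs (MulAction.IsPretransitive 𝒢.Adelic (𝒢.Adelic ⧸ 𝒢.quotientSubgroup))
  have hne := 𝒢.ne_zero_of_forall_rightRegular_apply_eq_smul μ hf hf0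
  have hmul := 𝒢.mul_of_forall_rightRegular_apply_eq_smul μ hf hf0
  -- the homomorphism `g ↦ c(g⁻¹)`
  set χ : 𝒢.Adelic →* ℂˣ :=
    { toFun := fun g => Units.mk0 (c g⁻¹) (hne g⁻¹)
      map_one' := by
        apply Units.ext
        have h1 : c 1 * c 1 = c 1 := by rw [← hmul, one_mul]
        simpa only [Units.val_mk0, inv_one, Units.val_one] using (mul_eq_right₀ (hne 1)).1 h1
      map_mul' := fun g k => by
        apply Units.ext
        simp only [Units.val_mk0, Units.val_mul, mul_inv_rev, hmul, mul_comm] } with hχ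
  have hχc : Continuous fun g => (χ g : ℂ) := by
    simp only [hχ, MonoidHom.coe_mk, OneHom.coe_mk, Units.val_mk0]
    exact (𝒢.continuous_of_forall_rightRegular_apply_eq_smul μ hf hf0).comp continuous_inv
  have hfm : StronglyMeasurable (f : 𝒢.automorphicQuotient → ℂ) := Lp.stronglyMeasurable f
  have hf0' : ¬ (f : 𝒢.automorphicQuotient → ℂ) =ᵐ[μ] 0 := fun h0 =>
    hf0 (Lp.eq_zero_iff_ae_eq_zero.2 h0)
  have hf' : ∀ g : 𝒢.Adelic, ∀ᵐ x ∂μ, (f : 𝒢.automorphicQuotient → ℂ) (g • x) = χ g * f x := by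
    intro g
    simpa only [hχ, MonoidHom.coe_mk, OneHom.coe_mk, Units.val_mk0] using
      𝒢.coeFn_smul_ae_eq_of_rightRegular_apply_eq_smul μ hf g
  have hstab_eq : MulAction.stabilizer 𝒢.Adelic (𝒢.toAutomorphicQuotient 1) = 𝒢.quotientSubgroup :=
    MulAction.stabilizer_quotient 𝒢.quotientSubgroup
  have hstab : h⁻¹ ∈ MulAction.stabilizer 𝒢.Adelic (𝒢.toAutomorphicQuotient 1) := by
    rw [hstab_eq]
    exact 𝒢.quotientSubgroup.inv_mem hh
  have h1 := eq_one_of_forall_smul_ae_eq_mul_of_mem_stabilizer μ hfm hf0' χ hχc hf' hstab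
  have h2 := congrArg (fun u : ℂˣ => (u : ℂ)) h1
  simpa only [hχ, MonoidHom.coe_mk, OneHom.coe_mk, Units.val_mk0, inv_inv, Units.val_one] using h2

end AdelicGroupData

namespace DiscreteAutomorphicRep

universe u

variable {K : Type} [Field K] [NumberField K] {𝒢 : AdelicGroupData.{u} K}
  [LocallyCompactSpace 𝒢.Adelic] [SecondCountableTopology 𝒢.Adelic]
  (μ : Measure 𝒢.automorphicQuotient) [𝒢.IsAutomorphicMeasure μ]

/-- **A discrete automorphic representation on which `G(𝔸_K)` acts by scalars is the line of an automorphic character**: if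
`R(g) v = c(g) v` for all `g` and all `v ∈ P`, then `P = ofChar ψ μ` for an automorphic character `ψ` with `ψ(g) = c(g)⁻¹` (★ `AutomorphicCharacter`:
`c` is multiplicative, unitary and continuous on a non-zero vector, and AUTOMORPHIC by `apply_eq_one_of_forall_rightRegular_apply_eq_smul`; then ★
`eq_ofChar_iff_forall_apply_eq_smul`).  ★ `exists_eq_ofChar` is the commutative case. [cite: BorelJacquet1979, §4.6] [cite: Gelbart1975, §2.A] -/
theorem exists_eq_ofChar_of_forall_apply_eq_smul (P : DiscreteAutomorphicRep 𝒢 μ) {c : 𝒢.Adelic → ℂ}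
    (hP : ∀ (g : 𝒢.Adelic) (v : P.space.toSubmodule), P.space.toContRep g v = c g • v) :
    ∃ ψ : 𝒢.AutomorphicCharacter, P = ofChar ψ μ := by
  -- a non-zero vector and its eigen-identities in `L²`
  haveI := P.nontrivial_space
  obtain ⟨v, hv0⟩ := exists_ne (0 : P.space.toSubmodule)
  set f : 𝒢.L2 μ := (v : 𝒢.L2 μ) with hfdef
  have hf0 : f ≠ 0 := fun h => hv0 (Subtype.ext h)
  have hf : ∀ g, 𝒢.rightRegular μ g f = c g • f := fun g => by
    have h1 := congrArg Subtype.val (hP g v)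
    rw [ContRepresentation.ClosedSubrep.coe_toContRep_apply] at h1
    exact h1
  have hne := 𝒢.ne_zero_of_forall_rightRegular_apply_eq_smul μ hf hf0
  have hmul := 𝒢.mul_of_forall_rightRegular_apply_eq_smul μ hf hf0
  have hnorm := 𝒢.norm_of_forall_rightRegular_apply_eq_smul μ hf hf0
  have hcont := 𝒢.continuous_of_forall_rightRegular_apply_eq_smul μ hf hf0
  have haut : ∀ h ∈ 𝒢.quotientSubgroup, c h = 1 := fun h hh =>
    𝒢.apply_eq_one_of_forall_rightRegular_apply_eq_smul μ hf hf0 hh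
  -- the automorphic character `ψ = c⁻¹`
  let χ : 𝒢.Adelic →* ℂˣ :=
    { toFun := fun g => (Units.mk0 (c g) (hne g))⁻¹
      map_one' := by
        rw [inv_eq_one]
        apply Units.ext
        have h1 : c 1 * c 1 = c 1 := by rw [← hmul, one_mul]
        simpa only [Units.val_mk0, Units.val_one] using (mul_eq_right₀ (hne 1)).1 h1
      map_mul' := fun g k => by
        rw [← mul_inv, mul_comm]
        congr 1
        apply Units.ext
        simp only [Units.val_mk0, Units.val_mul, hmul, mul_comm] }
  have hχval : ∀ g, ((χ g : ℂˣ) : ℂ) = (c g)⁻¹ := fun g => by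
    simp only [χ, MonoidHom.coe_mk, OneHom.coe_mk, Units.val_inv_eq_inv_val, Units.val_mk0]
  let ψ : 𝒢.AutomorphicCharacter :=
    { toMonoidHom := χ
      continuous_coe := by
        simp only [hχval]
        exact hcont.inv₀ hne
      norm_apply := fun g => by rw [hχval, norm_inv, hnorm, inv_one]
      map_eq_one_of_mem := fun g hg => by
        apply Units.ext
        rw [hχval, haut g hg, inv_one, Units.val_one] }
  refine ⟨ψ, (P.eq_ofChar_iff_forall_apply_eq_smul μ ψ).2 fun g w => ?_⟩
  have hψ : ((ψ g : ℂˣ) : ℂ)⁻¹ = c g := by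
    show ((χ g : ℂˣ) : ℂ)⁻¹ = c g
    rw [hχval, inv_inv]
  rw [hψ]
  exact hP g w

/-- **One-dimensional discrete automorphic representations of a general `G(𝔸_K)` are automorphic characters**: `P` one-dimensional ⇒
`P = ofChar ψ μ` for some automorphic `ψ` (a generator `v` of the line has `R(g) v = c(g) v`, and every vector is a multiple of `v`).  ★
`exists_eq_ofChar` ∕ `ofChar_bijective` needed `G(𝔸_K)` commutative. [cite: BorelJacquet1979, §4.6] [cite: Gelbart1975, §2.A] -/
theorem exists_eq_ofChar_of_isOneDimensional (P : DiscreteAutomorphicRep 𝒢 μ) (h1 : P.IsOneDimensional) :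
    ∃ ψ : 𝒢.AutomorphicCharacter, P = ofChar ψ μ := by
  obtain ⟨v, hv0, hv⟩ := finrank_eq_one_iff'.1 h1
  have hcex : ∀ g : 𝒢.Adelic, ∃ a : ℂ, a • v = P.space.toContRep g v := fun g => hv _
  choose c hc using hcex
  refine exists_eq_ofChar_of_forall_apply_eq_smul μ P (c := c) fun g w => ?_
  obtain ⟨a, ha⟩ := hv w
  rw [← ha, map_smul, ← hc g, smul_comm]

/-- **The one-dimensional discrete automorphic representations are EXACTLY the lines `ofChar ψ μ` of the automorphic characters** (★
`isOneDimensional_ofChar` for the converse). [cite: BorelJacquet1979, §4.6] -/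
theorem isOneDimensional_iff_exists_eq_ofChar (P : DiscreteAutomorphicRep 𝒢 μ) :
    P.IsOneDimensional ↔ ∃ ψ : 𝒢.AutomorphicCharacter, P = ofChar ψ μ := by
  refine ⟨exists_eq_ofChar_of_isOneDimensional μ P, ?_⟩
  rintro ⟨ψ, rfl⟩
  exact isOneDimensional_ofChar ψ μ

end DiscreteAutomorphicRep

end Literature.NumberTheory.Automorphic
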